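import Summits.QuantumFields.YangMills.Theorems.BalabanUVNodesPortZDStepLaw

/-!
# NODE O port, row PT-A′ helper lane (PTZ-1, gen 3): THE GIBBS SANDWICH of the step's log-moment — `⟨F⟩_{μ_A} ≤ log[T(I(A + F))(V) ∕ T(I(A))(V)] ≤ ⟨F⟩_{μ_{A+F}}` (Jensen under the
# `A`-step's fibre law below, Jensen under the `(A + F)`-step's fibre law above — NO smallness), hence two-sided FIRST-MOMENT bounds on the history channel: the zero-input fibre
# expectations of print's curly bracket bound `𝓓_{k+1}` from below, the full-input ones from above — generic over `Node00/ZeroInputStepT`, fibre laws DISPLAYED through `hμ`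

[Balaban1987RG1] = [I] (CMP 109, 1987): (1.6) p. 261, (2.12)–(2.14) p. 268; [Balaban1988RG2Cluster] = [II] (CMP 116, 1988): p. 21 (first-order bookkeeping of the history terms).

Seat `ymgap-nodeO-port-PTZ-1` g3 (prover, HELPER MODE; `--supports stmt-QuantumFields-27930 --as helper`).  Generic layer (0 tokens of the χ-cone of record); CRIT-1 Q-5 (β).  Companion of
`…PortZDStepLaw` (✓p807160: `jensen_integral_le_log_integral_exp`, `moment_eq_integral_exp_of_stepLaw`, `isProbabilityMeasure_of_stepLaw`) and `…PortZDHistoryFluctuation` (✓p805483).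
WHAT IS PROVED (0 sorry; no `def` ∕ `instance` ∕ `notation`):
* §1 `moment_inv_eq_integral_exp_neg_of_stepLaw` — under the fibre law `ν` of the `(A + F)`-step: `T(I(A))(V) ∕ T(I(A + F))(V) = ∫ e^{−F} dν` (`I(A) = e^{−F}·I(A + F)`);
  ★ `log_moment_le_mean_tilted_of_stepLaw` — GIBBS: `log[T(I(A + F))(V) ∕ T(I(A))(V)] ≤ ∫ F dν` (`F`, `e^{−F}` `ν`-integrable; both steps defined at `V`);
  ★ `mean_le_log_moment_of_stepLaw` — JENSEN (restated from `…PortZDStepLaw` in the same currency): `∫ F dμ ≤ log[T(I(A + F))(V) ∕ T(I(A))(V)]` (`μ` the `A`-step's law).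
* §2 ★★ `stepOutT_add_sub_firstMoment_bounds` — for `T K k` degree-one homogeneous, the laws `μW, μ1` of the `A`-step and `νW, ν1` of the `(A + E)`-step at `W`, `1`:
  `⟨E − E(bg_W)⟩_{μW} − ⟨E − E(bg_1)⟩_{ν1} ≤ R_k(A + E)(W) − R_k(A)(W) + E(bg_1) ≤ ⟨E − E(bg_W)⟩_{νW} − ⟨E − E(bg_1)⟩_{μ1}`;
  ★★ `dChannel_firstMoment_bounds` — the instance `(A⁰_k, 𝐄_k)` with `GaugeInvariant A_k`: THE HISTORY CHANNEL LIES BETWEEN THE CROSSED FIRST MOMENTS of print's curly bracket under the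
  ZERO-INPUT and the FULL-INPUT fibre laws (no smallness of the bracket needed; complements `…PortZDStepLaw`'s variance booking).
HONEST FRAMING.  Jensen twice (Mathlib-level, via this seat's fibre-law interface); fibre laws, positivity, integrability and `GaugeInvariant A_k` are HYPOTHESES displayed by name; NOTHING of
Bałaban's estimates asserted, ported or discharged; no named fact introduced; 26648 ∕ 27930⁸ SIGNED·OPEN (content-gated), 27931 OPEN (RC-3), 27932 CLOSED; K0⁷ ∕ K-Ax OPEN; counts unmoved;
finite 𝕋⁴ at fixed ε — NOT continuum ∕ OS ∕ Clay; the Yang–Mills mass gap is NOT proved by any of this.  No `sorry`, no `instance`, no `notation`, no `def`.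
-/

noncomputable section

open MeasureTheory

namespace Summit.QuantumFields.YangMills.Theorems.PortZD

open Literature.MathematicalPhysics.QuantumFieldTheory.Balaban1983to89
open Literature.MathematicalPhysics.QuantumFieldTheory.Balaban1983to89.Node00
open Literature.MathematicalPhysics.QuantumFieldTheory.Balaban1983to89.Node00.ZeroInput
open T4Continuum (T4Family)
open B12Eq019ActionBody (nextAction normConst integrand integrand_apply)
open GaugeField (GaugeInvariant)

/-! ## §1. Gibbs above, Jensen below -/

section StepLaw

variable {P : Params} {G : Type*} {k : ℕ} [MeasurableSpace (GaugeField P k G)]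

/-- Under the fibre law `ν` of the `(A + F)`-step at `V`: `T(I(A))(V) ∕ T(I(A + F))(V) = ∫ e^{−F} dν` (the moment identity of `…PortZDStepLaw` at `(A + F, −F)`, with `(A + F) + (−F) = A`).
[cite: Balaban1987RG1, (2.12)–(2.13) p.268 (bookkeeping)] -/
theorem moment_inv_eq_integral_exp_neg_of_stepLaw {T : Density P k G → Density P (k + 1) G} {χ GF : Density P k G} {gk : ℝ} {A F : Density P k G}
    {V : GaugeField P (k + 1) G} {ν : Measure (GaugeField P k G)}
    (hν : ∀ f : Density P k G, ∫ U, f U ∂ν = T (fun U => f U * integrand χ GF gk (A + F) U) V / T (integrand χ GF gk (A + F)) V) :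
    T (integrand χ GF gk A) V / T (integrand χ GF gk (A + F)) V = ∫ U, Real.exp (-F U) ∂ν := by
  have h := moment_eq_integral_exp_of_stepLaw hν (-F)
  have hAF : A + F + -F = A := by funext U; simp
  rw [hAF] at h
  simpa only [Pi.neg_apply] using h

/-- ★ **GIBBS**: `log[T(I(A + F))(V) ∕ T(I(A))(V)] ≤ ∫ F dν` for the fibre law `ν` of the `(A + F)`-step (both steps defined at `V`; `F`, `e^{−F}` `ν`-integrable) — Jensen under the TILTED law.
[cite: Balaban1988RG2Cluster, p.21 (bookkeeping: first-order control of the history terms)] -/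
theorem log_moment_le_mean_tilted_of_stepLaw {T : Density P k G → Density P (k + 1) G} {χ GF : Density P k G} {gk : ℝ} {A F : Density P k G}
    {V : GaugeField P (k + 1) G} {ν : Measure (GaugeField P k G)}
    (hν : ∀ f : Density P k G, ∫ U, f U ∂ν = T (fun U => f U * integrand χ GF gk (A + F) U) V / T (integrand χ GF gk (A + F)) V)
    (hA : 0 < T (integrand χ GF gk A) V) (hAF : 0 < T (integrand χ GF gk (A + F)) V)
    (hF : Integrable F ν) (hexp : Integrable (fun U => Real.exp (-F U)) ν) :
    Real.log (T (integrand χ GF gk (A + F)) V / T (integrand χ GF gk A) V) ≤ ∫ U, F U ∂ν := by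
  haveI := isProbabilityMeasure_of_stepLaw hν hAF.ne'
  have hJ := jensen_integral_le_log_integral_exp hF.neg (by simpa only [Pi.neg_apply] using hexp)
  simp only [Pi.neg_apply] at hJ
  rw [integral_neg, ← moment_inv_eq_integral_exp_neg_of_stepLaw hν, Real.log_div hA.ne' hAF.ne'] at hJ
  rw [Real.log_div hAF.ne' hA.ne']
  linarith

/-- ★ **JENSEN** (in the same currency): `∫ F dμ ≤ log[T(I(A + F))(V) ∕ T(I(A))(V)]` for the fibre law `μ` of the `A`-step (the `A`-step defined at `V`; `F`, `e^{F}` `μ`-integrable).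
[cite: Balaban1988RG2Cluster, p.21 (bookkeeping)] -/
theorem mean_le_log_moment_of_stepLaw {T : Density P k G → Density P (k + 1) G} {χ GF : Density P k G} {gk : ℝ} {A F : Density P k G}
    {V : GaugeField P (k + 1) G} {μ : Measure (GaugeField P k G)}
    (hμ : ∀ f : Density P k G, ∫ U, f U ∂μ = T (fun U => f U * integrand χ GF gk A U) V / T (integrand χ GF gk A) V)
    (hA : T (integrand χ GF gk A) V ≠ 0) (hF : Integrable F μ) (hexp : Integrable (fun U => Real.exp (F U)) μ) :
    ∫ U, F U ∂μ ≤ Real.log (T (integrand χ GF gk (A + F)) V / T (integrand χ GF gk A) V) := by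
  haveI := isProbabilityMeasure_of_stepLaw hμ hA
  rw [moment_eq_integral_exp_of_stepLaw hμ F]
  exact jensen_integral_le_log_integral_exp hF hexp

end StepLaw

/-! ## §2. Two-sided first-moment bounds on the history response and on the channel -/

variable (F : T4Family) (N : ℕ) [NeZero N]

/-- ★★ **CROSSED FIRST-MOMENT BOUNDS ON THE HISTORY RESPONSE**: `T K k` degree-one homogeneous; `μW, μ1` the fibre laws of the `A`-step and `νW, ν1` those of the `(A + E)`-step at `W`, `1`
(displayed); both steps defined at `W`, `1`; the brackets `F_V := E − E(bg_V)` integrable with `e^{F_V}` (`μ`-side) resp. `e^{−F_V}` (`ν`-side) integrable.  Then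
`⟨F_W⟩_{μW} − ⟨F_1⟩_{ν1} ≤ R_k(A + E)(W) − R_k(A)(W) + E(bg_1) ≤ ⟨F_W⟩_{νW} − ⟨F_1⟩_{μ1}`. [cite: Balaban1987RG1, (1.6) p.261, (2.12)–(2.14) p.268; Balaban1988RG2Cluster, p.21] -/
theorem stepOutT_add_sub_firstMoment_bounds (T : Transport F N) (χ : (K : ℕ) → (ℕ → ℝ) → (k : ℕ) → Density (F.P K) k (SU N)) (ε : ℝ) (K : ℕ)
    (g : ℕ → ℝ) (k : ℕ) (hT : ∀ (a : ℝ) (ρ : Density (F.P K) k (SU N)), T K k (fun U => a * ρ U) = fun V => a * T K k ρ V)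
    (A E : Density (F.P K) k (SU N)) (W : GaugeField (F.P K) (k + 1) (SU N)) {μW μ1 νW ν1 : Measure (GaugeField (F.P K) k (SU N))}
    (hμW : ∀ f : Density (F.P K) k (SU N),
      ∫ U, f U ∂μW = T K k (fun U => f U * integrand (χ K g k) (gfOfRecord F N K k) (g k) A U) W / T K k (integrand (χ K g k) (gfOfRecord F N K k) (g k) A) W)
    (hμ1 : ∀ f : Density (F.P K) k (SU N),
      ∫ U, f U ∂μ1 = T K k (fun U => f U * integrand (χ K g k) (gfOfRecord F N K k) (g k) A U) 1 / T K k (integrand (χ K g k) (gfOfRecord F N K k) (g k) A) 1)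
    (hνW : ∀ f : Density (F.P K) k (SU N),
      ∫ U, f U ∂νW = T K k (fun U => f U * integrand (χ K g k) (gfOfRecord F N K k) (g k)
          (A + fun U => E U - E (Averaging.iter (avOfRecord F N K) k (Uk F N K (k + 1) ε W))) U) W /
        T K k (integrand (χ K g k) (gfOfRecord F N K k) (g k) (A + fun U => E U - E (Averaging.iter (avOfRecord F N K) k (Uk F N K (k + 1) ε W)))) W)
    (hν1 : ∀ f : Density (F.P K) k (SU N),
      ∫ U, f U ∂ν1 = T K k (fun U => f U * integrand (χ K g k) (gfOfRecord F N K k) (g k)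
          (A + fun U => E U - E (Averaging.iter (avOfRecord F N K) k (Uk F N K (k + 1) ε 1))) U) 1 /
        T K k (integrand (χ K g k) (gfOfRecord F N K k) (g k) (A + fun U => E U - E (Averaging.iter (avOfRecord F N K) k (Uk F N K (k + 1) ε 1)))) 1)
    (hAW : 0 < T K k (integrand (χ K g k) (gfOfRecord F N K k) (g k) A) W)
    (hA1 : 0 < T K k (integrand (χ K g k) (gfOfRecord F N K k) (g k) A) 1)
    (hEW : 0 < T K k (integrand (χ K g k) (gfOfRecord F N K k) (g k) (A + E)) W)
    (hE1 : 0 < T K k (integrand (χ K g k) (gfOfRecord F N K k) (g k) (A + E)) 1)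
    (hiμW : Integrable (fun U => E U - E (Averaging.iter (avOfRecord F N K) k (Uk F N K (k + 1) ε W))) μW)
    (heμW : Integrable (fun U => Real.exp (E U - E (Averaging.iter (avOfRecord F N K) k (Uk F N K (k + 1) ε W)))) μW)
    (hiμ1 : Integrable (fun U => E U - E (Averaging.iter (avOfRecord F N K) k (Uk F N K (k + 1) ε 1))) μ1)
    (heμ1 : Integrable (fun U => Real.exp (E U - E (Averaging.iter (avOfRecord F N K) k (Uk F N K (k + 1) ε 1)))) μ1)
    (hiνW : Integrable (fun U => E U - E (Averaging.iter (avOfRecord F N K) k (Uk F N K (k + 1) ε W))) νW)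
    (heνW : Integrable (fun U => Real.exp (-(E U - E (Averaging.iter (avOfRecord F N K) k (Uk F N K (k + 1) ε W))))) νW)
    (hiν1 : Integrable (fun U => E U - E (Averaging.iter (avOfRecord F N K) k (Uk F N K (k + 1) ε 1))) ν1)
    (heν1 : Integrable (fun U => Real.exp (-(E U - E (Averaging.iter (avOfRecord F N K) k (Uk F N K (k + 1) ε 1))))) ν1) :
    (∫ U, (E U - E (Averaging.iter (avOfRecord F N K) k (Uk F N K (k + 1) ε W))) ∂μW) -
        (∫ U, (E U - E (Averaging.iter (avOfRecord F N K) k (Uk F N K (k + 1) ε 1))) ∂ν1) ≤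
      stepOutT F N T χ ε K g k (A + E) W - stepOutT F N T χ ε K g k A W + E (Averaging.iter (avOfRecord F N K) k (Uk F N K (k + 1) ε 1)) ∧
    stepOutT F N T χ ε K g k (A + E) W - stepOutT F N T χ ε K g k A W + E (Averaging.iter (avOfRecord F N K) k (Uk F N K (k + 1) ε 1)) ≤
      (∫ U, (E U - E (Averaging.iter (avOfRecord F N K) k (Uk F N K (k + 1) ε W))) ∂νW) -
        ∫ U, (E U - E (Averaging.iter (avOfRecord F N K) k (Uk F N K (k + 1) ε 1))) ∂μ1 := by
  set cW := E (Averaging.iter (avOfRecord F N K) k (Uk F N K (k + 1) ε W)) with hcW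
  set c1 := E (Averaging.iter (avOfRecord F N K) k (Uk F N K (k + 1) ε 1)) with hc1
  -- the re-centred steps are defined
  have hXW : 0 < T K k (integrand (χ K g k) (gfOfRecord F N K k) (g k) (A + fun U => E U - cW)) W := by
    have h := hEW; rw [transport_integrand_add_recentre hT _ _ _ A E cW W] at h
    exact pos_of_mul_pos_right h (Real.exp_pos _).le
  have hX1 : 0 < T K k (integrand (χ K g k) (gfOfRecord F N K k) (g k) (A + fun U => E U - c1)) 1 := by
    have h := hE1; rw [transport_integrand_add_recentre hT _ _ _ A E c1 1] at h
    exact pos_of_mul_pos_right h (Real.exp_pos _).le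
  rw [stepOutT_add_sub_eq_log_fluct F N T χ ε K g k hT A E W hAW hA1 hEW hE1, sub_add_cancel]
  have loW := mean_le_log_moment_of_stepLaw hμW hAW.ne' hiμW heμW
  have lo1 := mean_le_log_moment_of_stepLaw hμ1 hA1.ne' hiμ1 heμ1
  have upW := log_moment_le_mean_tilted_of_stepLaw hνW hAW hXW hiνW heνW
  have up1 := log_moment_le_mean_tilted_of_stepLaw hν1 hA1 hX1 hiν1 heν1
  constructor <;> linarith

/-- ★★ **THE HISTORY CHANNEL LIES BETWEEN THE CROSSED FIRST MOMENTS OF PRINT'S CURLY BRACKET** under the zero-input (`μ`) and the full-input (`ν`) fibre laws at `W` and at `1`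
(`A := A⁰_k`, `E := 𝐄_k`, `GaugeInvariant A_k` for the unit normalisation, `ε > 0`, `k + 1 ≤ m + K`; both steps defined at `W`, `1`; integrability displayed):
`⟨𝐄_k − 𝐄_k(bg_W)⟩⁰_W − ⟨𝐄_k⟩^{A_k}_1 ≤ 𝓓_{k+1}(W) ≤ ⟨𝐄_k − 𝐄_k(bg_W)⟩^{A_k}_W − ⟨𝐄_k⟩⁰_1`. [cite: Balaban1987RG1, (1.6) p.261, (2.12)–(2.14) p.268, (2.16) p.269; Balaban1988RG2Cluster, p.21] -/
theorem dChannel_firstMoment_bounds (T : Transport F N) (χ : (K : ℕ) → (ℕ → ℝ) → (k : ℕ) → Density (F.P K) k (SU N)) {ε : ℝ} (hε : 0 < ε)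
    {K : ℕ} (g : ℕ → ℝ) {k : ℕ} (hk : k + 1 ≤ (F.P K).m + (F.P K).K)
    (hT : ∀ (a : ℝ) (ρ : Density (F.P K) k (SU N)), T K k (fun U => a * ρ U) = fun V => a * T K k ρ V)
    (hinv : GaugeInvariant (effActionHT F N T χ K g k)) (W : GaugeField (F.P K) (k + 1) (SU N)) {μW μ1 νW ν1 : Measure (GaugeField (F.P K) k (SU N))}
    (hμW : ∀ f : Density (F.P K) k (SU N),
      ∫ U, f U ∂μW = T K k (fun U => f U * integrand (χ K g k) (gfOfRecord F N K k) (g k) (mainTermT F N ε K g k) U) W /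
        T K k (integrand (χ K g k) (gfOfRecord F N K k) (g k) (mainTermT F N ε K g k)) W)
    (hμ1 : ∀ f : Density (F.P K) k (SU N),
      ∫ U, f U ∂μ1 = T K k (fun U => f U * integrand (χ K g k) (gfOfRecord F N K k) (g k) (mainTermT F N ε K g k) U) 1 /
        T K k (integrand (χ K g k) (gfOfRecord F N K k) (g k) (mainTermT F N ε K g k)) 1)
    (hνW : ∀ f : Density (F.P K) k (SU N),
      ∫ U, f U ∂νW = T K k (fun U => f U * integrand (χ K g k) (gfOfRecord F N K k) (g k)
          (mainTermT F N ε K g k + fun U => EkT F N T χ ε K g k U - EkT F N T χ ε K g k (Averaging.iter (avOfRecord F N K) k (Uk F N K (k + 1) ε W))) U) W /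
        T K k (integrand (χ K g k) (gfOfRecord F N K k) (g k)
          (mainTermT F N ε K g k + fun U => EkT F N T χ ε K g k U - EkT F N T χ ε K g k (Averaging.iter (avOfRecord F N K) k (Uk F N K (k + 1) ε W)))) W)
    (hν1 : ∀ f : Density (F.P K) k (SU N),
      ∫ U, f U ∂ν1 = T K k (fun U => f U * integrand (χ K g k) (gfOfRecord F N K k) (g k) (effActionHT F N T χ K g k) U) 1 /
        T K k (integrand (χ K g k) (gfOfRecord F N K k) (g k) (effActionHT F N T χ K g k)) 1)
    (h0W : 0 < T K k (integrand (χ K g k) (gfOfRecord F N K k) (g k) (mainTermT F N ε K g k)) W)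
    (h01 : 0 < T K k (integrand (χ K g k) (gfOfRecord F N K k) (g k) (mainTermT F N ε K g k)) 1)
    (hW : 0 < T K k (integrand (χ K g k) (gfOfRecord F N K k) (g k) (effActionHT F N T χ K g k)) W)
    (h1 : 0 < T K k (integrand (χ K g k) (gfOfRecord F N K k) (g k) (effActionHT F N T χ K g k)) 1)
    (hiμW : Integrable (fun U => EkT F N T χ ε K g k U - EkT F N T χ ε K g k (Averaging.iter (avOfRecord F N K) k (Uk F N K (k + 1) ε W))) μW)
    (heμW : Integrable (fun U => Real.exp (EkT F N T χ ε K g k U - EkT F N T χ ε K g k (Averaging.iter (avOfRecord F N K) k (Uk F N K (k + 1) ε W)))) μW)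
    (hiμ1 : Integrable (EkT F N T χ ε K g k) μ1)
    (heμ1 : Integrable (fun U => Real.exp (EkT F N T χ ε K g k U)) μ1)
    (hiνW : Integrable (fun U => EkT F N T χ ε K g k U - EkT F N T χ ε K g k (Averaging.iter (avOfRecord F N K) k (Uk F N K (k + 1) ε W))) νW)
    (heνW : Integrable (fun U => Real.exp (-(EkT F N T χ ε K g k U - EkT F N T χ ε K g k (Averaging.iter (avOfRecord F N K) k (Uk F N K (k + 1) ε W))))) νW)
    (hiν1 : Integrable (EkT F N T χ ε K g k) ν1)
    (heν1 : Integrable (fun U => Real.exp (-EkT F N T χ ε K g k U)) ν1) :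
    (∫ U, (EkT F N T χ ε K g k U - EkT F N T χ ε K g k (Averaging.iter (avOfRecord F N K) k (Uk F N K (k + 1) ε W))) ∂μW) -
        (∫ U, EkT F N T χ ε K g k U ∂ν1) ≤ mergedTermT F N T χ ε K g k W - zeroInputMergedTermT F N T χ ε K g k W ∧
    mergedTermT F N T χ ε K g k W - zeroInputMergedTermT F N T χ ε K g k W ≤
      (∫ U, (EkT F N T χ ε K g k U - EkT F N T χ ε K g k (Averaging.iter (avOfRecord F N K) k (Uk F N K (k + 1) ε W))) ∂νW) -
        ∫ U, EkT F N T χ ε K g k U ∂μ1 := by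
  have h0 := EkT_iter_Uk_one_of_gaugeInvariant F N T χ hε g hk hinv
  have hfun : (mainTermT F N ε K g k + fun U => EkT F N T χ ε K g k U - EkT F N T χ ε K g k (Averaging.iter (avOfRecord F N K) k (Uk F N K (k + 1) ε 1))) =
      effActionHT F N T χ K g k := by
    funext U; rw [Pi.add_apply, h0, sub_zero, effActionHT_eq_main_add_Ek]
  have hW' : 0 < T K k (integrand (χ K g k) (gfOfRecord F N K k) (g k) (mainTermT F N ε K g k + EkT F N T χ ε K g k)) W := by
    rwa [← effActionHT_eq_main_add_Ek_fun]
  have h1' : 0 < T K k (integrand (χ K g k) (gfOfRecord F N K k) (g k) (mainTermT F N ε K g k + EkT F N T χ ε K g k)) 1 := by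
    rwa [← effActionHT_eq_main_add_Ek_fun]
  have h := stepOutT_add_sub_firstMoment_bounds F N T χ ε K g k hT (mainTermT F N ε K g k) (EkT F N T χ ε K g k) W (νW := νW) (ν1 := ν1) hμW hμ1 hνW
    (by rw [hfun]; exact hν1) h0W h01 hW' h1' hiμW heμW (by simpa only [h0, sub_zero] using hiμ1) (by simpa only [h0, sub_zero] using heμ1) hiνW heνW
    (by simpa only [h0, sub_zero] using hiν1) (by simpa only [h0, sub_zero] using heν1)
  simpa only [h0, sub_zero, add_zero, ← effActionHT_eq_main_add_Ek_fun, ← mergedTermT_eq_stepOut, ← zeroInputMergedTermT_eq_stepOut] using h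

end Summit.QuantumFields.YangMills.Theorems.PortZD

end
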